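import Summits.QuantumFields.YangMills.Theorems.LangevinControlUVFemtoCurvatureTwoPointCOddVarianceBulk
import HarnessLib

/-!
# Route `LangevinControlUV`, crux `FemtoCurvatureTwoPointC` (stmt-QuantumFields-16204), line
# `conditional-covariance-floor` — stub V-corner (`stub_varianceCeilingCorner`): the variance
# ceiling in the deep-femto corner `L⁴ < log β`, BOTH parities, REDUCED to the uniform corner doubling

The skeleton stub V-corner (reshape v3) asks, for a compact simple `G`, a faithful unitary `r` and a
GIVEN box coupling `u` carrying the R-bundle, for `β₁ C'` with
`Var_{L,β}(P_0^{01}) = E(P_0·P_0) − E(P_0)² ≤ C'·u(8,β)²` on every window box `L ≥ 8` in the corner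
`L⁴ < log β`, `P_x = N − Re tr r.ρ(U_{x;01})`. Everything else of the variance clause V is landed:
EVEN boxes with `log β ≤ L⁴` (`TorusGauge.varianceCeilingEven_bulk4`, p153416; p150733/p155166) and
ODD boxes with `log β ≤ L⁴` (`OddVariance.varianceCeilingOdd_bulk4`, p161704). Both proofs use the
restriction `log β ≤ L⁴` ONLY through the volume-uniform torus doubling
`Z_L(β/2) ≤ e^{A L⁴} Z_L(β)` (`TorusGauge.uniformDoubling_bulk4`).

This file makes that observation a kernel-checked BRIDGE. It isolates the doubling as a POINTWISE
hypothesis at one `(L, β)`: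

* `CornerVariance.varianceEven_of_doubling` — even `L`, `2 ≤ β`, doubling at `(L, β)` with constant
  `A` ⟹ `Var ≤ (16 e^{A}/e²)/β²` (chessboard estimate p114602 + AM–GM
  `PlaquetteVariance.wilsonExpectation_prod_sq_le` + Gibbs–Jensen `⟨e^{βS/2}⟩_β = Z(β/2)/Z(β)`; the
  body of `varianceCeilingEven_bulk4` verbatim);
* `CornerVariance.varianceOdd_of_doubling` — odd `L ≥ 3`, `2 ≤ β`, doubling at `(L, β)` ⟹
  `Var ≤ (16 e^{16 max(A,0)}/e²)/β²` (partial chessboard on odd tori `OddChessboard.odd_partialChessboard`,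
  p161454, `n⁴` sites with `L < 2n`, + `OddVariance.integral_prod_plaq_sq_le`; the body of
  `varianceCeilingOdd_bulk4` verbatim);
* `CornerVariance.varianceCeiling_corner_of_UDC` — the `u`-free corner ceiling on BOTH parities,
  `Var ≤ C/β²` for `L ≥ 2`, `2 ≤ β`, `L⁴ < log β`, FROM the uniform corner doubling UDC
  (`∃ A, ∀ L ≥ 2, ∀ β ≥ 2, L⁴ < log β → Z_L(β/2) ≤ e^{AL⁴} Z_L(β)`, second countability of `G` read
  off the faithful `r`);
* `varianceCeilingCorner_of_uniformDoublingCorner` (registered sub-goal,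
  `--supports stmt-QuantumFields-16204`) — UDC ⟹ the registered stub statement VERBATIM, by the
  bare-size conversion `C/β² ≤ (max C 0/c₈²)·u(8,β)²` of p155166/p161704 (only `0 < c₈` and
  `c₈ ≤ β·u(8,β)` of the R-bundle are used; the window hypothesis and compact simplicity are unused).

What stays OPEN: UDC itself (`uniformDoubling_corner`) — the `2D·log β` holonomy slack of the landed
torus free-energy sandwich `|log Z_L(β) + (3D/2)L⁴ log β| ≤ A L⁴ + 2D log β` (`…CTorusLower` p146937,
`…CBulkDoublingSharp` p153416): the exact fixed-`L` Laplace exponent of `Z_L` at the commuting variety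
`Hom(ℤ⁴, G)`, uniformly in `L`. Nothing here is physics beyond the cited landed theorems; no named
facts, no new definitions.
-/

set_option autoImplicit false

noncomputable section

open scoped BigOperators
open Filter Topology MeasureTheory
open Literature.MathematicalPhysics.QuantumFieldTheory
open Summit.QuantumFields.YangMills.Theorems.FemtoCurvatureTwoPoint.PlaquetteVariance
open Summit.QuantumFields.YangMills.Cruxes.FemtoCurvatureTwoPoint.GenericStepGammaEncoding
  (PlaquetteChessboardEven plaquetteChessboardEven_holds)

namespace Summit.QuantumFields.YangMills.Theorems.FemtoCurvatureTwoPointC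

namespace CornerVariance

section Pointwise

variable {G : Type} [Group G] [TopologicalSpace G] [IsTopologicalGroup G] [CompactSpace G]
  [MeasurableSpace G] [BorelSpace G]

/-- **Even torus: doubling at `(L, β)` ⟹ variance ceiling at `(L, β)`.** For a compact group `G`
with a lattice representation `r`, an EVEN torus `(ℤ/L)⁴` and `2 ≤ β`: if
`Z_L(β/2) ≤ e^{A L⁴} Z_L(β)` then `⟨P_0 P_0⟩_β − ⟨P_0⟩_β² ≤ (16 e^{A}/e²)·(β²)⁻¹`,
`P_0 = N − Re tr r.ρ(U_{0;01})` — chessboard estimate (`plaquetteChessboardEven_holds`, p114602) with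
`f = min(t², 4N²)`, AM–GM `⟨∏ₓ P_x²⟩ ≤ (4/(eβ))^{2L⁴} Z(β/2)/Z(β)`, and the `L⁴`-th root. The body of
`TorusGauge.varianceCeilingEven_bulk4` with the doubling taken as a hypothesis. -/
-- adapted from `TorusGauge.varianceCeilingEven_bulk4` (`…CBulkDoublingSharp`, p153416)
theorem varianceEven_of_doubling (r : LatticeRep G) (A : ℝ) (L : ℕ) [NeZero L] (hL : Even L)
    (β : ℝ) (hβ : 2 ≤ β)
    (hdbl : (partitionFunction (d := 4) (L := L) r.ρ (β / 2)).toReal ≤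
      Real.exp (A * (L : ℝ) ^ 4) * (partitionFunction (d := 4) (L := L) r.ρ β).toReal)
    (P : (Fin 4 → ZMod L) → Fin 4 → Fin 4 → GaugeConfig 4 L G → ℝ)
    (E : (GaugeConfig 4 L G → ℝ) → ℝ)
    (hP : P = fun x i j U => (r.N : ℝ) - (r.ρ (plaquetteHolonomy U x i j)).trace.re)
    (hE : E = fun F => wilsonExpectation r.ρ β F) :
    E (fun U => P 0 0 1 U * P 0 0 1 U) - E (P 0 0 1) * E (P 0 0 1) ≤
      16 * Real.exp A / Real.exp 1 ^ 2 * (β ^ 2)⁻¹ := by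
  subst hP hE
  dsimp only
  have hβ0 : 0 < β := by linarith
  -- (i) `|Var P| ≤ ⟨P²⟩`
  have hXm := measurable_plaq01 r.ρ r.continuous (0 : Site 4 L)
  have hXb : ∀ U : GaugeConfig 4 L G,
      |(r.N : ℝ) - (r.ρ (plaquetteHolonomy U 0 0 1)).trace.re| ≤ 2 * r.N := fun U => by
    obtain ⟨h0, h2'⟩ := plaqField_mem r.ρ r.continuous (plaquetteHolonomy U 0 0 1)
    rw [abs_of_nonneg h0]
    exact h2'
  have hvar := abs_var_le_wilsonExpectation_sq r.ρ r.continuous β hXm hXb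
  -- (ii) chessboard (landed, all even tori) with `f = min (t², 4N²)`, `f(P_x) = P_x²`
  have hCh : PlaquetteChessboardEven := plaquetteChessboardEven_holds
  unfold PlaquetteChessboardEven at hCh
  have hmin : ∀ (U : GaugeConfig 4 L G) (x : Site 4 L),
      min (((r.N : ℝ) - (r.ρ (plaquetteHolonomy U x 0 1)).trace.re) ^ 2) ((2 * (r.N : ℝ)) ^ 2) =
        ((r.N : ℝ) - (r.ρ (plaquetteHolonomy U x 0 1)).trace.re) ^ 2 := fun U x => by
    obtain ⟨h0, h2'⟩ := plaqField_mem r.ρ r.continuous (plaquetteHolonomy U x 0 1)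
    exact min_eq_left (pow_le_pow_left₀ h0 h2' 2)
  have hf := hCh G r.N r.ρ r.continuous r.mem_unitary L hL β hβ0.le
    (fun t => min (t ^ 2) ((2 * (r.N : ℝ)) ^ 2))
    ((continuous_id.pow 2).min continuous_const).measurable
    (fun t => le_min (sq_nonneg t) (sq_nonneg _)) ⟨(2 * (r.N : ℝ)) ^ 2, fun t => min_le_right _ _⟩
  simp only [hmin] at hf
  -- (iii)–(v) `⟨∏ₓ P_x²⟩ ≤ M^{L⁴}` with `M = (4/(eβ))² e^{A}`
  have hprod : wilsonExpectation r.ρ β (fun U : GaugeConfig 4 L G =>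
      ∏ x : Site 4 L, ((r.N : ℝ) - (r.ρ (plaquetteHolonomy U x 0 1)).trace.re) ^ 2) ≤
        ((4 / (Real.exp 1 * β)) ^ 2 * Real.exp A) ^ (L ^ 4) := by
    refine (wilsonExpectation_prod_sq_le r.ρ r.continuous hβ0).trans ?_
    have hZ := partitionFunction_toReal_pos (d := 4) (L := L) r.ρ r.continuous β
    have hratio : (partitionFunction (d := 4) (L := L) r.ρ (β / 2)).toReal /
        (partitionFunction (d := 4) (L := L) r.ρ β).toReal ≤ Real.exp (A * (L : ℝ) ^ 4) := by
      rw [div_le_iff₀ hZ]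
      exact hdbl
    calc (4 / (Real.exp 1 * β)) ^ (2 * L ^ 4) *
          ((partitionFunction (d := 4) (L := L) r.ρ (β / 2)).toReal /
            (partitionFunction (d := 4) (L := L) r.ρ β).toReal)
        ≤ (4 / (Real.exp 1 * β)) ^ (2 * L ^ 4) * Real.exp (A * (L : ℝ) ^ 4) :=
          mul_le_mul_of_nonneg_left hratio (pow_nonneg (by positivity) _)
      _ = ((4 / (Real.exp 1 * β)) ^ 2 * Real.exp A) ^ (L ^ 4) := by
          rw [pow_mul, mul_pow, ← Real.exp_nat_mul]
          congr 2
          push_cast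
          ring
  -- (vi) the `L⁴`-th root
  have hroot : (wilsonExpectation r.ρ β (fun U : GaugeConfig 4 L G =>
      ∏ x : Site 4 L, ((r.N : ℝ) - (r.ρ (plaquetteHolonomy U x 0 1)).trace.re) ^ 2)) ^
        ((1 : ℝ) / (L : ℝ) ^ 4) ≤ (4 / (Real.exp 1 * β)) ^ 2 * Real.exp A := by
    have h0 : 0 ≤ wilsonExpectation r.ρ β (fun U : GaugeConfig 4 L G =>
        ∏ x : Site 4 L, ((r.N : ℝ) - (r.ρ (plaquetteHolonomy U x 0 1)).trace.re) ^ 2) :=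
      wilsonExpectation_nonneg r.ρ β fun U => Finset.prod_nonneg fun x _ => sq_nonneg _
    have hM0 : 0 ≤ (4 / (Real.exp 1 * β)) ^ 2 * Real.exp A := by positivity
    have hk0 : L ^ 4 ≠ 0 := pow_ne_zero 4 (NeZero.ne L)
    calc _ ≤ (((4 / (Real.exp 1 * β)) ^ 2 * Real.exp A) ^ (L ^ 4)) ^ ((1 : ℝ) / (L : ℝ) ^ 4) :=
          Real.rpow_le_rpow h0 hprod (by positivity)
      _ = (4 / (Real.exp 1 * β)) ^ 2 * Real.exp A := by
          rw [one_div, ← Nat.cast_pow]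
          exact Real.pow_rpow_inv_natCast hM0 hk0
  -- assembly: `Var ≤ |Var| ≤ ⟨P²⟩ ≤ ⟨∏ₓ P_x²⟩^{1/L⁴} ≤ (4/(eβ))² e^{A} = C · (β²)⁻¹`
  have hβne : β ≠ 0 := hβ0.ne'
  calc _ ≤ (4 / (Real.exp 1 * β)) ^ 2 * Real.exp A :=
        (le_abs_self _).trans (hvar.trans (hf.trans hroot))
    _ = 16 * Real.exp A / Real.exp 1 ^ 2 * (β ^ 2)⁻¹ := by
        field_simp
        ring

/-- **Odd torus: doubling at `(L, β)` ⟹ variance ceiling at `(L, β)`.** For a compact group `G`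
with a lattice representation `r`, an ODD torus `(ℤ/L)⁴` with `L ≥ 3` and `2 ≤ β`: if
`Z_L(β/2) ≤ e^{A L⁴} Z_L(β)` then `⟨P_0 P_0⟩_β − ⟨P_0⟩_β² ≤ (16 e^{16 max(A,0)}/e²)·(β²)⁻¹` — the
partial chessboard `OddChessboard.odd_partialChessboard` (p161454: `n⁴` sites, `L < 2n`) with
`f = min(t², 4N²)`, `∫ ∏_{x∈B} P_x² ≤ (4/(eβ))^{2|B|} Z(β/2)/Z(β)` (`OddVariance.integral_prod_plaq_sq_le`),
the `n⁴`-th root and `L⁴ ≤ 16 n⁴`. The body of `OddVariance.varianceCeilingOdd_bulk4` with the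
doubling taken as a hypothesis. -/
-- adapted from `OddVariance.varianceCeilingOdd_bulk4` (`…COddVarianceBulk`, p161704)
theorem varianceOdd_of_doubling (r : LatticeRep G) (A : ℝ) (L : ℕ) [NeZero L] (hL : Odd L)
    (hL3 : 3 ≤ L) (β : ℝ) (hβ : 2 ≤ β)
    (hdbl : (partitionFunction (d := 4) (L := L) r.ρ (β / 2)).toReal ≤
      Real.exp (A * (L : ℝ) ^ 4) * (partitionFunction (d := 4) (L := L) r.ρ β).toReal)
    (P : (Fin 4 → ZMod L) → Fin 4 → Fin 4 → GaugeConfig 4 L G → ℝ)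
    (E : (GaugeConfig 4 L G → ℝ) → ℝ)
    (hP : P = fun x i j U => (r.N : ℝ) - (r.ρ (plaquetteHolonomy U x i j)).trace.re)
    (hE : E = fun F => wilsonExpectation r.ρ β F) :
    E (fun U => P 0 0 1 U * P 0 0 1 U) - E (P 0 0 1) * E (P 0 0 1) ≤
      16 * Real.exp (16 * max A 0) / Real.exp 1 ^ 2 * (β ^ 2)⁻¹ := by
  subst hP hE
  dsimp only
  have hβ0 : 0 < β := by linarith
  -- (i) `|Var P| ≤ ⟨P²⟩`
  have hXm := measurable_plaq01 r.ρ r.continuous (0 : Site 4 L)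
  have hXb : ∀ U : GaugeConfig 4 L G,
      |(r.N : ℝ) - (r.ρ (plaquetteHolonomy U 0 0 1)).trace.re| ≤ 2 * r.N := fun U => by
    obtain ⟨h0, h2'⟩ := plaqField_mem r.ρ r.continuous (plaquetteHolonomy U 0 0 1)
    rw [abs_of_nonneg h0]
    exact h2'
  have hvar := abs_var_le_wilsonExpectation_sq r.ρ r.continuous β hXm hXb
  -- (ii) the partial chessboard on the odd torus with `f = min (t², 4N²)`, `f(P_x) = P_x²`
  have hmin : ∀ (U : GaugeConfig 4 L G) (x : Site 4 L),
      min (((r.N : ℝ) - (r.ρ (plaquetteHolonomy U x 0 1)).trace.re) ^ 2) ((2 * (r.N : ℝ)) ^ 2) =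
        ((r.N : ℝ) - (r.ρ (plaquetteHolonomy U x 0 1)).trace.re) ^ 2 := fun U x => by
    obtain ⟨h0, h2'⟩ := plaqField_mem r.ρ r.continuous (plaquetteHolonomy U x 0 1)
    exact min_eq_left (pow_le_pow_left₀ h0 h2' 2)
  obtain ⟨n, hn, B, hBcard, hch⟩ := OddChessboard.odd_partialChessboard r.ρ hL hL3 r.continuous
    hβ0.le (f := fun t => min (t ^ 2) ((2 * (r.N : ℝ)) ^ 2))
    ((continuous_id.pow 2).min continuous_const).measurable
    (fun t => le_min (sq_nonneg t) (sq_nonneg _))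
    (M := (2 * (r.N : ℝ)) ^ 2) (fun t => by
      rw [abs_of_nonneg (le_min (sq_nonneg t) (sq_nonneg _))]; exact min_le_right _ _)
  simp only [hmin] at hch
  have hn0 : 0 < n := by omega
  have hBne : B.Nonempty := Finset.card_pos.1 (by rw [hBcard]; positivity)
  -- (iii) `∫ ∏_{x∈B} P_x² ≤ (4/(eβ))^{2n⁴} e^{AL⁴}`
  have hprod : ∫ U, ∏ x ∈ B, ((r.N : ℝ) - (r.ρ (plaquetteHolonomy U x 0 1)).trace.re) ^ 2
      ∂(wilsonMeasure (d := 4) (L := L) r.ρ β) ≤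
        (4 / (Real.exp 1 * β)) ^ (2 * n ^ 4) * Real.exp (A * (L : ℝ) ^ 4) := by
    refine (OddVariance.integral_prod_plaq_sq_le r.ρ r.continuous hβ0 B hBne).trans ?_
    have hZ := partitionFunction_toReal_pos (d := 4) (L := L) r.ρ r.continuous β
    have hratio : (partitionFunction (d := 4) (L := L) r.ρ (β / 2)).toReal /
        (partitionFunction (d := 4) (L := L) r.ρ β).toReal ≤ Real.exp (A * (L : ℝ) ^ 4) := by
      rw [div_le_iff₀ hZ]
      exact hdbl
    rw [hBcard]
    exact mul_le_mul_of_nonneg_left hratio (pow_nonneg (by positivity) _)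
  -- (iv) the `n⁴`-th root: `⟨P²⟩ ≤ (4/(eβ))² e^{AL⁴/n⁴}`
  set a : ℝ := ∫ U, ((r.N : ℝ) - (r.ρ (plaquetteHolonomy U 0 0 1)).trace.re) ^ 2
    ∂(wilsonMeasure (d := 4) (L := L) r.ρ β) with ha
  set b : ℝ := (4 / (Real.exp 1 * β)) ^ 2 * Real.exp (A * (L : ℝ) ^ 4 / (n : ℝ) ^ 4) with hb
  have hb0 : 0 ≤ b := by positivity
  have hn4 : ((n : ℝ) ^ 4) ≠ 0 := by positivity
  have hbn : b ^ (n ^ 4) = (4 / (Real.exp 1 * β)) ^ (2 * n ^ 4) * Real.exp (A * (L : ℝ) ^ 4) := by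
    rw [hb, mul_pow, ← pow_mul, ← Real.exp_nat_mul]
    congr 2
    push_cast
    field_simp
  have hab : a ≤ b :=
    le_of_pow_le_pow_left₀ (pow_ne_zero 4 hn0.ne') hb0 (by rw [hbn]; exact hch.trans hprod)
  -- (v) `e^{AL⁴/n⁴} ≤ e^{16 max(A,0)}` since `L < 2n`
  have hL2n : (L : ℝ) ^ 4 ≤ 16 * (n : ℝ) ^ 4 := by
    have h : (L : ℝ) ≤ 2 * n := by exact_mod_cast hn.le
    calc (L : ℝ) ^ 4 ≤ (2 * (n : ℝ)) ^ 4 := pow_le_pow_left₀ (by positivity) h 4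
      _ = 16 * (n : ℝ) ^ 4 := by ring
  have hexp : Real.exp (A * (L : ℝ) ^ 4 / (n : ℝ) ^ 4) ≤ Real.exp (16 * max A 0) := by
    refine Real.exp_le_exp.2 ?_
    rw [div_le_iff₀ (by positivity)]
    have h1 : A * (L : ℝ) ^ 4 ≤ max A 0 * (L : ℝ) ^ 4 :=
      mul_le_mul_of_nonneg_right (le_max_left _ _) (by positivity)
    have h2 : max A 0 * (L : ℝ) ^ 4 ≤ max A 0 * (16 * (n : ℝ) ^ 4) :=
      mul_le_mul_of_nonneg_left hL2n (le_max_right _ _)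
    linarith
  -- assembly
  have hβne : β ≠ 0 := hβ0.ne'
  calc _ ≤ a := (le_abs_self _).trans hvar
    _ ≤ b := hab
    _ ≤ (4 / (Real.exp 1 * β)) ^ 2 * Real.exp (16 * max A 0) :=
        mul_le_mul_of_nonneg_left hexp (by positivity)
    _ = 16 * Real.exp (16 * max A 0) / Real.exp 1 ^ 2 * (β ^ 2)⁻¹ := by
        field_simp
        ring

end Pointwise

/-- **The `u`-free variance ceiling in the deep-femto corner, BOTH parities, from the uniform corner
doubling.** If UDC holds — for every compact second-countable `G` with a lattice representation `r`
ONE `A` with `Z_L(β/2) ≤ e^{A L⁴} Z_L(β)` for all `L ≥ 2`, `β ≥ 2`, `L⁴ < log β` — then for every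
compact `G` with a lattice representation `r` there is ONE `C = 16 e^{16 max(A,0)}/e²` with
`⟨P_0 P_0⟩_β − ⟨P_0⟩_β² ≤ C·(β²)⁻¹` on every torus `(ℤ/L)⁴`, `L ≥ 2`, at every `β ≥ 2` with
`L⁴ < log β`: `varianceEven_of_doubling` on even tori (`e^{A} ≤ e^{16 max(A,0)}`),
`varianceOdd_of_doubling` on odd tori (`L ≥ 3`); `G` is second countable through the faithful `r`. -/
theorem varianceCeiling_corner_of_UDC
    (hUDC : ∀ {G : Type} [Group G] [TopologicalSpace G] [IsTopologicalGroup G] [CompactSpace G]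
      [MeasurableSpace G] [BorelSpace G] [SecondCountableTopology G] (r : LatticeRep G),
      ∃ A : ℝ, ∀ (L : ℕ) [NeZero L] (β : ℝ), 2 ≤ L → 2 ≤ β → (L : ℝ) ^ 4 < Real.log β →
        (partitionFunction (d := 4) (L := L) r.ρ (β / 2)).toReal ≤
          Real.exp (A * (L : ℝ) ^ 4) * (partitionFunction (d := 4) (L := L) r.ρ β).toReal)
    {G : Type} [Group G] [TopologicalSpace G] [IsTopologicalGroup G] [CompactSpace G]
    [MeasurableSpace G] [BorelSpace G] (r : LatticeRep G) :
    ∃ C : ℝ, ∀ (L : ℕ) [NeZero L], 2 ≤ L → ∀ β : ℝ, 2 ≤ β → (L : ℝ) ^ 4 < Real.log β →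
      ∀ (P : (Fin 4 → ZMod L) → Fin 4 → Fin 4 → GaugeConfig 4 L G → ℝ)
        (E : (GaugeConfig 4 L G → ℝ) → ℝ),
        (P = fun x i j U => (r.N : ℝ) - (r.ρ (plaquetteHolonomy U x i j)).trace.re) →
        (E = fun F => wilsonExpectation r.ρ β F) →
        E (fun U => P 0 0 1 U * P 0 0 1 U) - E (P 0 0 1) * E (P 0 0 1) ≤ C * (β ^ 2)⁻¹ := by
  -- `G` is second countable: it embeds into `M_N(ℂ)` through the faithful `r`
  haveI : SecondCountableTopology (Matrix (Fin r.N) (Fin r.N) ℂ) :=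
    inferInstanceAs (SecondCountableTopology (Fin r.N → Fin r.N → ℂ))
  haveI : SecondCountableTopology G :=
    (r.continuous.isClosedEmbedding r.injective).isEmbedding.secondCountableTopology
  obtain ⟨A, hA⟩ := hUDC r
  refine ⟨16 * Real.exp (16 * max A 0) / Real.exp 1 ^ 2, ?_⟩
  intro L iL hL2 β hβ hlogβ P E hP hE
  have hβ0 : 0 < β := by linarith
  -- the corner doubling at `(L, β)`
  have hdbl : (partitionFunction (d := 4) (L := L) r.ρ (β / 2)).toReal ≤
      Real.exp (A * (L : ℝ) ^ 4) * (partitionFunction (d := 4) (L := L) r.ρ β).toReal :=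
    hA L β hL2 hβ hlogβ
  rcases Nat.even_or_odd L with hev | hodd
  · -- even torus: constant `16 e^{A}/e² ≤ 16 e^{16 max(A,0)}/e²`
    refine (varianceEven_of_doubling r A L hev β hβ hdbl P E hP hE).trans ?_
    have hexp : Real.exp A ≤ Real.exp (16 * max A 0) :=
      Real.exp_le_exp.2 (by linarith [le_max_left A 0, le_max_right A 0])
    have hβ2 : 0 ≤ (β ^ 2)⁻¹ := inv_nonneg.2 (sq_nonneg β)
    have h16 : 16 * Real.exp A / Real.exp 1 ^ 2 ≤ 16 * Real.exp (16 * max A 0) / Real.exp 1 ^ 2 :=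
      div_le_div_of_nonneg_right (by linarith) (by positivity)
    exact mul_le_mul_of_nonneg_right h16 hβ2
  · -- odd torus, `L ≥ 3`
    have hL3 : 3 ≤ L := by
      obtain ⟨m, hm⟩ := hodd
      omega
    exact varianceOdd_of_doubling r A L hodd hL3 β hβ hdbl P E hP hE

end CornerVariance

/-- **Variance combination (pure real arithmetic).** From the bare size `c₈ ≤ β·t` with `0 < c₈`
and `1 ≤ β`, and a bare variance ceiling `V ≤ C₃·(β²)⁻¹`: `V ≤ (max C₃ 0 / c₈²)·t²`. [folklore] -/
-- adapted from `variance_combine_mid` of `…CBirthVarianceEvenMidStub` (p155166, private there)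
private theorem variance_combine_corner {V C₃ c₈ β t : ℝ} (hc₈ : 0 < c₈) (hβ : 1 ≤ β)
    (hbare : c₈ ≤ β * t) (hV : V ≤ C₃ * (β ^ 2)⁻¹) :
    V ≤ max C₃ 0 / c₈ ^ 2 * t ^ 2 := by
  have hβpos : 0 < β := one_pos.trans_le hβ
  have hβ2 : 0 < β ^ 2 := pow_pos hβpos 2
  have hc2 : 0 < c₈ ^ 2 := pow_pos hc₈ 2
  have hsq : c₈ ^ 2 ≤ β ^ 2 * t ^ 2 := by
    rw [← mul_pow]
    exact pow_le_pow_left₀ hc₈.le hbare 2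
  have hinv : (β ^ 2)⁻¹ ≤ t ^ 2 / c₈ ^ 2 := by
    rw [inv_eq_one_div, div_le_div_iff₀ hβ2 hc2]
    linarith [hsq]
  calc V ≤ C₃ * (β ^ 2)⁻¹ := hV
    _ ≤ max C₃ 0 * (β ^ 2)⁻¹ :=
        mul_le_mul_of_nonneg_right (le_max_left _ _) (inv_nonneg.mpr hβ2.le)
    _ ≤ max C₃ 0 * (t ^ 2 / c₈ ^ 2) := mul_le_mul_of_nonneg_left hinv (le_max_right _ _)
    _ = max C₃ 0 / c₈ ^ 2 * t ^ 2 := by ring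

/-- **Registered sub-goal `varianceCeilingCorner_of_uniformDoublingCorner` — the V-corner bridge of
line `conditional-covariance-floor` (both parities).** The uniform corner doubling UDC — for every
compact second-countable `G` with a lattice representation `r` ONE `A` with
`Z_L(β/2) ≤ e^{A L⁴}·Z_L(β)` for all `L ≥ 2`, `β ≥ 2`, `L⁴ < log β` — implies the registered skeleton
stub `stub_varianceCeilingCorner` VERBATIM: for a compact simple Lie group `G`, a lattice
representation `r` and a GIVEN box coupling `u` with constants `u₀ β₀ κ₁ κ₂ κ₃ c C c₈` carrying the
R-bundle, there are `β₁ C'` with `E(P_0^{01}·P_0^{01}) − E(P_0^{01})² ≤ C'·u(8,β)²` on every window box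
`L ≥ 8` with `L⁴ < log β` beyond `β₁`. Witnesses: `β₁ = max β₀ 2`, `C' = max C₅ 0 / c₈²` with `C₅`
the constant of `CornerVariance.varianceCeiling_corner_of_UDC`. Only `0 < c₈` and the bare-size clause
`c₈ ≤ β·u(8,β)` of the R-bundle are used; the window hypothesis and compact simplicity are not used. -/
theorem varianceCeilingCorner_of_uniformDoublingCorner :
    (∀ {G : Type} [Group G] [TopologicalSpace G] [IsTopologicalGroup G] [CompactSpace G]
      [MeasurableSpace G] [BorelSpace G] [SecondCountableTopology G] (r : LatticeRep G),
      ∃ A : ℝ, ∀ (L : ℕ) [NeZero L] (β : ℝ), 2 ≤ L → 2 ≤ β → (L : ℝ) ^ 4 < Real.log β →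
        (partitionFunction (d := 4) (L := L) r.ρ (β / 2)).toReal ≤
          Real.exp (A * (L : ℝ) ^ 4) * (partitionFunction (d := 4) (L := L) r.ρ β).toReal) →
    ∀ (G : Type) [Group G] [TopologicalSpace G] [IsTopologicalGroup G] [CompactSpace G]
        [MeasurableSpace G] [BorelSpace G], IsCompactSimpleLieGroup G →
        ∀ r : LatticeRep G, ∀ (u : ℕ → ℝ → ℝ) (u₀ β₀ κ₁ κ₂ κ₃ c C c₈ : ℝ),
      (0 < u₀ ∧ 0 < c ∧ 0 < κ₁ ∧ 0 ≤ κ₃ ∧ 0 < c₈ ∧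
        (∀ (L : ℕ) (β : ℝ), 8 ≤ L → β₀ ≤ β → 0 < u L β) ∧
        (∀ L : ℕ, 8 ≤ L → ContinuousOn (u L) (Set.Ici β₀)) ∧
        (∀ L : ℕ, 8 ≤ L → Filter.Tendsto (u L) Filter.atTop (nhds 0)) ∧
        (∀ β : ℝ, β₀ ≤ β → c₈ ≤ β * u 8 β) ∧
        (∀ (L L' : ℕ) (β : ℝ), β₀ ≤ β → 8 ≤ L → L ≤ L' → L' ≤ 2 * L →
            (∀ M : ℕ, 8 ≤ M → M ≤ L → u M β ≤ u₀) → |(u L β)⁻¹ - (u L' β)⁻¹| ≤ κ₂) ∧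
        (∀ (k m : ℕ) (β : ℝ), β₀ ≤ β → (∀ M : ℕ, 8 ≤ M → M ≤ 8 * 2 ^ (k + m) → u M β ≤ u₀) →
            κ₁ * m - κ₃ ≤ (u (8 * 2 ^ k) β)⁻¹ - (u (8 * 2 ^ (k + m)) β)⁻¹ ∧
              (u (8 * 2 ^ k) β)⁻¹ - (u (8 * 2 ^ (k + m)) β)⁻¹ ≤ κ₂ * m + κ₃) ∧
        (∀ (L : ℕ) [NeZero L] (β : ℝ), β₀ ≤ β → 8 ≤ L →
            (∀ M : ℕ, 8 ≤ M → M ≤ L → u M β ≤ u₀) →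
            ∀ (P : (Fin 4 → ZMod L) → Fin 4 → Fin 4 → GaugeConfig 4 L G → ℝ)
              (E : (GaugeConfig 4 L G → ℝ) → ℝ),
              (P = fun x i j U => (r.N : ℝ) - (r.ρ (plaquetteHolonomy U x i j)).trace.re) →
              (E = fun F => wilsonExpectation r.ρ β F) →
              c * u L β ^ 2 ≤
                ((L / 8 : ℕ) : ℝ) ^ 8 * (E (fun U => P 0 0 1 U * P (Pi.single (2 : Fin 4) ((L / 8 : ℕ) : ZMod L)) 0 1 U)
                  - E (P 0 0 1) * E (P (Pi.single (2 : Fin 4) ((L / 8 : ℕ) : ZMod L)) 0 1)) ∧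
              ((L / 8 : ℕ) : ℝ) ^ 8 * (E (fun U => P 0 0 1 U * P (Pi.single (2 : Fin 4) ((L / 8 : ℕ) : ZMod L)) 0 1 U)
                - E (P 0 0 1) * E (P (Pi.single (2 : Fin 4) ((L / 8 : ℕ) : ZMod L)) 0 1)) ≤ C * u L β ^ 2)) →
      ∃ (β₁ C' : ℝ),
        (∀ (L : ℕ) [NeZero L] (β : ℝ), β₁ ≤ β → 8 ≤ L → (L : ℝ) ^ 4 < Real.log β →
            (∀ M : ℕ, 8 ≤ M → M ≤ L → u M β ≤ u₀) →
            ∀ (P : (Fin 4 → ZMod L) → Fin 4 → Fin 4 → GaugeConfig 4 L G → ℝ)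
              (E : (GaugeConfig 4 L G → ℝ) → ℝ),
              (P = fun x i j U => (r.N : ℝ) - (r.ρ (plaquetteHolonomy U x i j)).trace.re) →
              (E = fun F => wilsonExpectation r.ρ β F) →
              E (fun U => P 0 0 1 U * P 0 0 1 U) - E (P 0 0 1) * E (P 0 0 1) ≤ C' * u 8 β ^ 2) := by
  intro hUDC G _ _ _ _ _ _ _ r u u₀ β₀ κ₁ κ₂ κ₃ c C c₈ hR
  obtain ⟨-, -, -, -, hc₈, -, -, -, hbare, -, -, -⟩ := hR
  -- the `u`-free corner ceiling `Var ≤ C₅ / β²` on both parities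
  obtain ⟨Cb, hCb⟩ := CornerVariance.varianceCeiling_corner_of_UDC hUDC r
  refine ⟨max β₀ 2, max Cb 0 / c₈ ^ 2, ?_⟩
  intro L _ β hβ hL hlog _ P E hP hE
  have hβ₀ : β₀ ≤ β := (le_max_left _ _).trans hβ
  have hβ2 : (2 : ℝ) ≤ β := (le_max_right _ _).trans hβ
  have hβ1 : (1 : ℝ) ≤ β := by linarith
  have hL2 : 2 ≤ L := by omega
  -- the ceiling on the box `L ≥ 2` at coupling `2 ≤ β`, `L⁴ < log β`
  have hvar := hCb L hL2 β hβ2 hlog P E hP hE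
  -- the bare size at `β ≥ β₀`
  have hbs : c₈ ≤ β * u 8 β := hbare β hβ₀
  exact variance_combine_corner hc₈ hβ1 hbs hvar

end Summit.QuantumFields.YangMills.Theorems.FemtoCurvatureTwoPointC

end
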